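/-
Copyright (c) 2026 the pub-hodgecm-mathlib formalisation cell (harness21).  Prover seat hodgecm-mathlib-LH4-p13 (g3), req620 Track A «(D-RAM) FOUR-FRAME» squad
(heir LEAD F0P3a-plan lineage; dealer LH4-plan (g11) WORD #52 (b) «κG₂ G₂∕G₃-κ BY ROTATION»; κ-road of unit U3_Laws, the (κ-B₀) child `stub_U3_kappaCount_typeZero` of
`Cruxes/H413/Lines/F0_P3c_DyRamFourFrame_U3_Laws.lean` ED. 10).  2026-09-04.
-/
import Summits.HodgeConjecture.HodgeConjecture.Theorems.F0P3cDyRamDiagonalKappaPermutation   -- (this seat): `finsum_kappaCount_mul_stabiliserWeight_stratum_G2_of_G1 ∕ _G3_of_G1` (slot-permuting adapters); brings ★ §P∕§P₂, ★ Fκ1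
import Summits.HodgeConjecture.HodgeConjecture.Theorems.F0P3cDyRamDiagonalKappaGluedSocket   -- ★ κG-C2 p856706 (LH4-p09 (g3)): `finsum_kappaCount_mul_stabiliserWeight_hasAxis_G1` (the B₁-footed glued κ-socket, type 0)
import HarnessLib

/-!
# Crux `H413`, «(D-RAM) FOUR-FRAME» road, unit U3_Laws, κ-STAGE B: «THE GLUED κ-SOCKETS WITH FOOT ON `B₂` AND `B₃`, TYPE 0» — by rotation of LH4-p09 (g3)'s ★ G₁ κ-socket

Cell `hodgecm-mathlib` (D-0151), FLOOR 0, crux item H413 = `stmt-HodgeConjecture-24833`; lane `--supports stmt-HodgeConjecture-24833 --as helper` (count-neutral).  THEOREMS ONLY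
(no `def`, no instance, no notation, no `sorry`).  LH4-p09 (g3)'s ★ κG-C2 `finsum_kappaCount_mul_stabiliserWeight_hasAxis_G1` (p856706) evaluates the κ-weighted census
`Σᶠ_{M ∈ stratum σ ϖ T ![2ρ, 2ρ+s, 2ρ+s]} κ⁰_i(M)·w(M)` of the glued type-0 stratum with foot on `B₁` (TUBE + GLUE, letter `LETTER-kappaBG-RHS.v1.LH4p09g3` §5).  The (κ-B₀) assembler
(F0P3a-p01 (g32), dealer WORD #53) also needs the two ROTATED glued strata `(2ρ+s, 2ρ, 2ρ+s)` (foot on `B₂`) and `(2ρ+s, 2ρ+s, 2ρ)` (foot on `B₃`).  Unlike the multiplicity-weighted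
MS sockets (★ `GluedSocketTwoRotations`, this lineage), the κ-weight is slot-EQUIVARIANT: by this seat's κ-permutation rule `kappaCount σ ϖ tv i (P·M) = kappaCount σ ϖ tv (π i) M`
(file `…DiagonalKappaPermutation`), the rotated socket at slot `i` is the `B₁`-footed socket at the permuted slot, read at the permuted element datum:
* **`finsum_kappaCount_mul_stabiliserWeight_hasAxis_G2`** — axis `(2ρ+s, 2ρ, 2ρ+s)`: datum `(β, α; n₂, n₁, n₃)`, slots `0 ↔ 1` (apex slot = 1; glue witness condition
  `|f₀ + (α−1)∕(β−1)| ≤ |ϖ|^{2ρ+s−n₁}` on the glue regime `n₁ = n₃, n₂ = n₁+s, n₁ < 2ρ, 2ρ−n₁ ≤ n₁−d+1`);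
* **`finsum_kappaCount_mul_stabiliserWeight_hasAxis_G3`** — axis `(2ρ+s, 2ρ+s, 2ρ)`: datum `(α⁻¹, βα⁻¹; n₃, n₂, n₁)`, slots `0 ↔ 2` (apex slot = 2; glue witness condition
  `|f₀ + (β−α)∕(1−α)| ≤ |ϖ|^{2ρ+s−n₂}` on `n₂ = n₁, n₃ = n₂+s, n₂ < 2ρ, 2ρ−n₂ ≤ n₂−d+1`, since `(βα⁻¹−1)∕(α⁻¹−1) = (β−α)∕(1−α)`).
Binders otherwise VERBATIM those of ★ p856706 (`hD h2 hE hN₀ hT ρ s hρ hs i f₀ hf₀ hglue`), values = its RHS with the letters permuted, so the assembler pastes the three G-sockets alike.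
HONEST LABEL.  Count-neutral (`--supports`); law-free transport; the κ-census laws (KMS children) stay PROVER TARGETS until the κ-assemblers close; `HC_CM` is proved only modulo
the 7 printed citations (2 remaining named inputs: hLiu418 = `stmt-HodgeConjecture-24832`, h413 = `stmt-HodgeConjecture-24833`) until rung 0 closes.

## References
* [Kottwitz1986BaseChangeUnits] R. E. Kottwitz, *Base change for unit elements of Hecke algebras*, Compositio Math. 60 (1986), §1 pp. 240–241 (κ-orbital integrals of units as signed
  fixed-lattice counts modulo the torus).
* [LanglandsShelstad1987] R. P. Langlands, D. Shelstad, *On the definition of transfer factors*, Math. Ann. 278 (1987), §3 (κ as a character).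
* [Rogawski1990] J. D. Rogawski, *Automorphic Representations of Unitary Groups in Three Variables*, Ann. of Math. Stud. 123 (1990), §4.9 Prop. 4.9.1 (a) p. 55.
-/

set_option autoImplicit false

noncomputable section

namespace Summit.HodgeConjecture.HodgeConjecture.Cruxes.H413.F0P3cDyRamDiagonalKappaGluedRotations

open Matrix
open Literature.NumberTheory.Automorphic Literature.NumberTheory.Automorphic.HermitianLattice
open Literature.NumberTheory.Automorphic.UnitaryLatticeTree Literature.NumberTheory.Automorphic.UnitaryThreeFourFrame
open Literature.NumberTheory.LocalFields.WildQuadraticDatum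
open Summit.HodgeConjecture.HodgeConjecture.Cruxes.H413.F0P3cDyRamDiagonalTorusDefs
open Summit.HodgeConjecture.HodgeConjecture.Cruxes.H413.F0P3cDyRamDiagonalStrataDefs
open Summit.HodgeConjecture.HodgeConjecture.Cruxes.H413.F0P3cDyRamDiagonalKappaCountDefs
open Summit.HodgeConjecture.HodgeConjecture.Cruxes.H413.F0P3cDyRamDiagonalKappaPermutation
open Summit.HodgeConjecture.HodgeConjecture.Cruxes.H413.F0P3cDyRamDiagonalKappaGluedSocket (finsum_kappaCount_mul_stabiliserWeight_hasAxis_G1)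
open scoped Valued WithZero Matrix MatrixGroups

/-! ## §1  Slot vectors under the two transpositions -/

/-- `![a, b, c] (swap 0 1 i) = ![b, a, c] i`. [cite: LanglandsShelstad1987, §3] -/
theorem vec3_swap01 (a b c : ℚ) (i : Fin 3) : (![a, b, c] : Fin 3 → ℚ) (Equiv.swap (0 : Fin 3) 1 i) = (![b, a, c] : Fin 3 → ℚ) i := by
  fin_cases i <;> rfl

/-- `![a, b, c] (swap 0 2 i) = ![c, b, a] i`. [cite: LanglandsShelstad1987, §3] -/
theorem vec3_swap02 (a b c : ℚ) (i : Fin 3) : (![a, b, c] : Fin 3 → ℚ) (Equiv.swap (0 : Fin 3) 2 i) = (![c, b, a] : Fin 3 → ℚ) i := by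
  fin_cases i <;> rfl

/-! ## §2  The rotated glued κ-sockets, type 0 -/

section Sockets

variable {K : Type} [Field K] [Valued K ℤᵐ⁰] [CompleteSpace K] [Fintype 𝓀[K]] {σ : K →+* K} {ϖ : K} {d t : ℕ} {α β : K} {N₀ n₁ n₂ n₃ : ℕ}
  {T : GL (Fin 3) K}

/-- **κB-G «GLUED-STRATA κ-SOCKET», FOOT ON `B₂`, TYPE 0** — axis `(2ρ+s, 2ρ, 2ρ+s)`, `ρ, s ≥ 1`, slot `i`, any fixed `f₀` which ON THE GLUE REGIME (`2∣s`, `n₁ = n₃`, `n₂ = n₁+s`,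
`n₁ < 2ρ`, `2ρ−n₁ ≤ n₁−d+1`) approximates `−(α−1)∕(β−1)` to depth `2ρ+s−n₁`:  `Σᶠ κ⁰_i·w = [TUBE]_i + [GLUE]_i` with TUBE (`2∣s`, `2ρ ≤ min(n₁,n₃)`, `2ρ+s ≤ n₂`) =
`(0, ω(−1)·q^{2ρ+s∕2−1}·((q−1)[2d ≤ s] − [s+2 = 2d]), 0)_i` and GLUE = `([d ≤ ⌈(2ρ−n₁)∕2⌉]·ω(−1)ω(f₀)ω(1+f₀), [2d ≤ s + 2⌈(2ρ−n₁)∕2⌉]·ω(−1)ω(1+f₀), [d ≤ ⌈(2ρ−n₁)∕2⌉]·ω(f₀))_i ·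
q^{2ρ+s∕2−⌈(2ρ−n₁)∕2⌉}` — ★ p856706 at the swapped datum `(β, α; n₂, n₁, n₃)` through the κ-permutation rule (slots `0 ↔ 1`).
[cite: Kottwitz1986BaseChangeUnits, §1 pp. 240–241] [cite: LanglandsShelstad1987, §3] [cite: Rogawski1990, §4.9 Prop. 4.9.1 (a) p. 55] -/
theorem finsum_kappaCount_mul_stabiliserWeight_hasAxis_G2 (hD : IsRamifiedQuadraticDatum σ ϖ d t) (h2 : Valued.v (2 : K) < 1)
    (hE : IsElementDatum σ ϖ N₀ α β n₁ n₂ n₃) (hN₀ : d ≤ N₀) (hT : (T : Matrix (Fin 3) (Fin 3) K) = Matrix.diagonal ![α, β, 1])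
    (ρ s : ℕ) (hρ : 1 ≤ ρ) (hs : 1 ≤ s) (i : Fin 3) (f₀ : K) (hf₀ : σ f₀ = f₀)
    (hglue : 2 ∣ s → n₁ = n₃ → n₂ = n₁ + s → n₁ < 2 * ρ → 2 * ρ - n₁ ≤ n₁ - d + 1 → Valued.v (f₀ + (α - 1) / (β - 1)) ≤ Valued.v ϖ ^ (2 * ρ + s - n₁)) :
    ∑ᶠ M ∈ stratum σ ϖ T ![2 * ρ + s, 2 * ρ, 2 * ρ + s], (kappaCount σ ϖ 0 i M : ℚ) * stabiliserWeight σ M =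
      (if 2 ∣ s ∧ 2 * ρ ≤ min n₁ n₃ ∧ 2 * ρ + s ≤ n₂ then
          (![0, (normSign σ (-1 : K) : ℚ) * (Fintype.card 𝓀[K] : ℚ) ^ (2 * ρ + s / 2 - 1) *
              ((if 2 * d ≤ s then (Fintype.card 𝓀[K] : ℚ) - 1 else 0) - (if s + 2 = 2 * d then 1 else 0)), 0] : Fin 3 → ℚ) i
        else 0) +
      (if 2 ∣ s ∧ n₁ = n₃ ∧ n₂ = n₁ + s ∧ n₁ < 2 * ρ ∧ 2 * ρ - n₁ ≤ n₁ - d + 1 then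
          (![if d ≤ (2 * ρ - n₁ + 1) / 2 then (normSign σ (-1 : K) : ℚ) * normSign σ f₀ * normSign σ (1 + f₀) else 0,
             if 2 * d ≤ s + 2 * ((2 * ρ - n₁ + 1) / 2) then (normSign σ (-1 : K) : ℚ) * normSign σ (1 + f₀) else 0,
             if d ≤ (2 * ρ - n₁ + 1) / 2 then (normSign σ f₀ : ℚ) else 0] : Fin 3 → ℚ) i *
            (Fintype.card 𝓀[K] : ℚ) ^ (2 * ρ + s / 2 - (2 * ρ - n₁ + 1) / 2)
        else 0) := by
  -- the `B₁`-footed head as a slot vector `F` under the glue side condition `Hyp`, both over the element datum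
  have key := finsum_kappaCount_mul_stabiliserWeight_stratum_G2_of_G1 hE hT 0 (2 * ρ) s
    (fun α' β' n₁' n₂' n₃' => 2 ∣ s → n₂' = n₃' → n₁' = n₂' + s → n₂' < 2 * ρ → 2 * ρ - n₂' ≤ n₂' - d + 1 →
      Valued.v (f₀ + (β' - 1) / (α' - 1)) ≤ Valued.v ϖ ^ (2 * ρ + s - n₂'))
    (fun _ _ n₁' n₂' n₃' j =>
      (if 2 ∣ s ∧ 2 * ρ ≤ min n₂' n₃' ∧ 2 * ρ + s ≤ n₁' then
          (![(normSign σ (-1 : K) : ℚ) * (Fintype.card 𝓀[K] : ℚ) ^ (2 * ρ + s / 2 - 1) *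
              ((if 2 * d ≤ s then (Fintype.card 𝓀[K] : ℚ) - 1 else 0) - (if s + 2 = 2 * d then 1 else 0)), 0, 0] : Fin 3 → ℚ) j
        else 0) +
      (if 2 ∣ s ∧ n₂' = n₃' ∧ n₁' = n₂' + s ∧ n₂' < 2 * ρ ∧ 2 * ρ - n₂' ≤ n₂' - d + 1 then
          (![if 2 * d ≤ s + 2 * ((2 * ρ - n₂' + 1) / 2) then (normSign σ (-1 : K) : ℚ) * normSign σ (1 + f₀) else 0,
             if d ≤ (2 * ρ - n₂' + 1) / 2 then (normSign σ (-1 : K) : ℚ) * normSign σ f₀ * normSign σ (1 + f₀) else 0,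
             if d ≤ (2 * ρ - n₂' + 1) / 2 then (normSign σ f₀ : ℚ) else 0] : Fin 3 → ℚ) j *
            (Fintype.card 𝓀[K] : ℚ) ^ (2 * ρ + s / 2 - (2 * ρ - n₂' + 1) / 2)
        else 0))
    (fun T' hE' hT' hHyp j => finsum_kappaCount_mul_stabiliserWeight_hasAxis_G1 hD h2 hE' hN₀ hT' ρ s hρ hs j f₀ hf₀ hHyp) hglue i
  rw [key]
  simp only [vec3_swap01]

/-- **κB-G «GLUED-STRATA κ-SOCKET», FOOT ON `B₃`, TYPE 0** — axis `(2ρ+s, 2ρ+s, 2ρ)`, `ρ, s ≥ 1`, slot `i`, any fixed `f₀` which ON THE GLUE REGIME (`2∣s`, `n₂ = n₁`, `n₃ = n₂+s`,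
`n₂ < 2ρ`, `2ρ−n₂ ≤ n₂−d+1`) approximates `−(β−α)∕(1−α)` to depth `2ρ+s−n₂`:  `Σᶠ κ⁰_i·w = [TUBE]_i + [GLUE]_i` with TUBE (`2∣s`, `2ρ ≤ min(n₂,n₁)`, `2ρ+s ≤ n₃`) =
`(0, 0, ω(−1)·q^{2ρ+s∕2−1}·((q−1)[2d ≤ s] − [s+2 = 2d]))_i` and GLUE = `([d ≤ ⌈(2ρ−n₂)∕2⌉]·ω(f₀), [d ≤ ⌈(2ρ−n₂)∕2⌉]·ω(−1)ω(f₀)ω(1+f₀), [2d ≤ s + 2⌈(2ρ−n₂)∕2⌉]·ω(−1)ω(1+f₀))_i ·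
q^{2ρ+s∕2−⌈(2ρ−n₂)∕2⌉}` — ★ p856706 at the rescaled datum `(α⁻¹, βα⁻¹; n₃, n₂, n₁)` through the κ-permutation rule (slots `0 ↔ 2`); `(βα⁻¹−1)∕(α⁻¹−1) = (β−α)∕(1−α)`.
[cite: Kottwitz1986BaseChangeUnits, §1 pp. 240–241] [cite: LanglandsShelstad1987, §3] [cite: Rogawski1990, §4.9 Prop. 4.9.1 (a) p. 55] -/
theorem finsum_kappaCount_mul_stabiliserWeight_hasAxis_G3 (hD : IsRamifiedQuadraticDatum σ ϖ d t) (h2 : Valued.v (2 : K) < 1)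
    (hE : IsElementDatum σ ϖ N₀ α β n₁ n₂ n₃) (hN₀ : d ≤ N₀) (hT : (T : Matrix (Fin 3) (Fin 3) K) = Matrix.diagonal ![α, β, 1])
    (ρ s : ℕ) (hρ : 1 ≤ ρ) (hs : 1 ≤ s) (i : Fin 3) (f₀ : K) (hf₀ : σ f₀ = f₀)
    (hglue : 2 ∣ s → n₂ = n₁ → n₃ = n₂ + s → n₂ < 2 * ρ → 2 * ρ - n₂ ≤ n₂ - d + 1 → Valued.v (f₀ + (β - α) / (1 - α)) ≤ Valued.v ϖ ^ (2 * ρ + s - n₂)) :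
    ∑ᶠ M ∈ stratum σ ϖ T ![2 * ρ + s, 2 * ρ + s, 2 * ρ], (kappaCount σ ϖ 0 i M : ℚ) * stabiliserWeight σ M =
      (if 2 ∣ s ∧ 2 * ρ ≤ min n₂ n₁ ∧ 2 * ρ + s ≤ n₃ then
          (![0, 0, (normSign σ (-1 : K) : ℚ) * (Fintype.card 𝓀[K] : ℚ) ^ (2 * ρ + s / 2 - 1) *
              ((if 2 * d ≤ s then (Fintype.card 𝓀[K] : ℚ) - 1 else 0) - (if s + 2 = 2 * d then 1 else 0))] : Fin 3 → ℚ) i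
        else 0) +
      (if 2 ∣ s ∧ n₂ = n₁ ∧ n₃ = n₂ + s ∧ n₂ < 2 * ρ ∧ 2 * ρ - n₂ ≤ n₂ - d + 1 then
          (![if d ≤ (2 * ρ - n₂ + 1) / 2 then (normSign σ f₀ : ℚ) else 0,
             if d ≤ (2 * ρ - n₂ + 1) / 2 then (normSign σ (-1 : K) : ℚ) * normSign σ f₀ * normSign σ (1 + f₀) else 0,
             if 2 * d ≤ s + 2 * ((2 * ρ - n₂ + 1) / 2) then (normSign σ (-1 : K) : ℚ) * normSign σ (1 + f₀) else 0] : Fin 3 → ℚ) i *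
            (Fintype.card 𝓀[K] : ℚ) ^ (2 * ρ + s / 2 - (2 * ρ - n₂ + 1) / 2)
        else 0) := by
  have hvσ : ∀ a, Valued.v (σ a) = Valued.v a := hD.2.1
  -- the glue unit of the rescaled datum: `(βα⁻¹ − 1)∕(α⁻¹ − 1) = (β − α)∕(1 − α)`
  have hα : α * σ α = 1 := hE.1
  have hα0 : α ≠ 0 := fun h => by rw [h, zero_mul] at hα; exact zero_ne_one hα
  have hα1 : α ≠ 1 := hE.2.2.2.1
  have hfrac : (β * α⁻¹ - 1) / (α⁻¹ - 1) = (β - α) / (1 - α) := by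
    have h1α : (1 : K) - α ≠ 0 := sub_ne_zero.2 (Ne.symm hα1)
    have hi : α⁻¹ - 1 = (1 - α) * α⁻¹ := by field_simp
    have hn : β * α⁻¹ - 1 = (β - α) * α⁻¹ := by field_simp
    rw [hi, hn, mul_div_mul_right _ _ (inv_ne_zero hα0)]
  have key := finsum_kappaCount_mul_stabiliserWeight_stratum_G3_of_G1 hvσ hE hT 0 (2 * ρ) s
    (fun α' β' n₁' n₂' n₃' => 2 ∣ s → n₂' = n₃' → n₁' = n₂' + s → n₂' < 2 * ρ → 2 * ρ - n₂' ≤ n₂' - d + 1 →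
      Valued.v (f₀ + (β' - 1) / (α' - 1)) ≤ Valued.v ϖ ^ (2 * ρ + s - n₂'))
    (fun _ _ n₁' n₂' n₃' j =>
      (if 2 ∣ s ∧ 2 * ρ ≤ min n₂' n₃' ∧ 2 * ρ + s ≤ n₁' then
          (![(normSign σ (-1 : K) : ℚ) * (Fintype.card 𝓀[K] : ℚ) ^ (2 * ρ + s / 2 - 1) *
              ((if 2 * d ≤ s then (Fintype.card 𝓀[K] : ℚ) - 1 else 0) - (if s + 2 = 2 * d then 1 else 0)), 0, 0] : Fin 3 → ℚ) j
        else 0) +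
      (if 2 ∣ s ∧ n₂' = n₃' ∧ n₁' = n₂' + s ∧ n₂' < 2 * ρ ∧ 2 * ρ - n₂' ≤ n₂' - d + 1 then
          (![if 2 * d ≤ s + 2 * ((2 * ρ - n₂' + 1) / 2) then (normSign σ (-1 : K) : ℚ) * normSign σ (1 + f₀) else 0,
             if d ≤ (2 * ρ - n₂' + 1) / 2 then (normSign σ (-1 : K) : ℚ) * normSign σ f₀ * normSign σ (1 + f₀) else 0,
             if d ≤ (2 * ρ - n₂' + 1) / 2 then (normSign σ f₀ : ℚ) else 0] : Fin 3 → ℚ) j *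
            (Fintype.card 𝓀[K] : ℚ) ^ (2 * ρ + s / 2 - (2 * ρ - n₂' + 1) / 2)
        else 0))
    (fun T' hE' hT' hHyp j => finsum_kappaCount_mul_stabiliserWeight_hasAxis_G1 hD h2 hE' hN₀ hT' ρ s hρ hs j f₀ hf₀ hHyp)
    (fun h1 h2' h3 h4 h5 => by rw [hfrac]; exact hglue h1 h2' h3 h4 h5) i
  rw [key]
  simp only [vec3_swap02]

end Sockets

end Summit.HodgeConjecture.HodgeConjecture.Cruxes.H413.F0P3cDyRamDiagonalKappaGluedRotations

end
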